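import Mathlib
import Summits.HubbardSuperconductivity.HubbardSuperconductivity.Theses.AposterioriCapRg
import Summits.HubbardSuperconductivity.HubbardSuperconductivity.Theorems.TwSourcedCondensation.Negative.SourceResponseStructure
import Summits.HubbardSuperconductivity.HubbardSuperconductivity.Theorems.VisonPairCost.Negative.GaugeStructure
import Literature.MathematicalPhysics.QuantumLattice.XYOrderDischarges

/-!
# SketchIdeator1 — crux-ideate stmt-HubbardSuperconductivity-14047 (SeededBrokenRegimeBoseFermiPinned), round 1, ideator 1

§1  First lemmas (statements, `def … : Prop`) of the three crux idea cards
    `rotation-identity-goldstone-pin` (A), `sector-number-small-parameter` (B), `seed-strength-flow` (C);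
    every constant exists in the tree: `Matrix.groundEnergy`, `hubbardTorusWith`, `pairField`, `dWaveFormFactor`,
    `dWaveSourceTorus`, `ShellGeometry`, `renormalisedBandC`, `partialD`, `TrigPolyC4v`, `nambuPropagatorCT`,
    `matsubaraFreq`, `nambuXiCT`, `dWaveSymbol`, `FreqMomentum`.
§2  Card A's first lemma PROVED (`seedRotationIdentity`, `seedRotationIdentity_holds`; 0 sorry): the ground energy of
    the Hubbard torus seeded by an arbitrary COMPLEX `d`-wave pair source `z̄Δ_d + zΔ_dᴴ` depends on `|z|` only — the
    constant gauge rotation `W = phaseGauge(e^{-iθ/2})`, `θ = arg z`, fixes `K₀ = hubbardTorusWith 2 L 1 U μ`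
    (tree: `phaseGauge_const_conj_hamiltonianWith`) and multiplies `Δ_d` by `conj(e^{-iθ/2})² = e^{iθ}`; the ground
    energy is unitarily invariant (tree: `groundEnergy_unitary_conj'`).
-/

noncomputable section

namespace Summit.HubbardSuperconductivity.HubbardSuperconductivity.Cruxes.SeededBrokenRegimeBoseFermiPinned.IdeasR1K1

open Matrix Finset Literature.MathematicalPhysics.QuantumLattice Literature.Probability.LatticeModels
open Summit.HubbardSuperconductivity.HubbardSuperconductivity.Theorems.TwSourcedCondensation.Negative
open scoped ComplexConjugate ComplexOrder

/-! ## §1 First lemmas (statements) -/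



/-- Card A (rotation-identity-goldstone-pin), first lemma, MODEL level: the ground energy of the Hubbard torus
seeded by an arbitrary complex `d`-wave pair source `z̄ Δ_d + z Δ_dᴴ`, `z = a + ib`, depends on `|z|` only
(global `U(1)` covariance: `e^{iφN/2} Δ_d e^{-iφN/2} = e^{-iφ} Δ_d`). Consequence (second-order in `b` at `b = 0`):
the transverse Duhamel pair susceptibility at zero momentum equals `ω_h(Δ_d + Δ_dᴴ)/(2h)` — Goldstone's theorem at
`q = 0` as an exact finite-volume identity, with no expansion in the transverse direction. -/
def SeedRotationIdentity : Prop :=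
  ∀ (L : ℕ) [NeZero L] (U μ a b : ℝ),
    Matrix.groundEnergy (hubbardTorusWith 2 L 1 U μ
        - (a : ℂ) • (pairField dWaveFormFactor L + (pairField dWaveFormFactor L)ᴴ)
        - (b : ℂ) • (Complex.I • ((pairField dWaveFormFactor L)ᴴ - pairField dWaveFormFactor L)))
      = Matrix.groundEnergy (dWaveSourceTorus L U μ (Real.sqrt (a ^ 2 + b ^ 2)))

/-- Card B (sector-number-small-parameter), first lemma: FMRT's `1/N` phase-space gain in CT-shell form. For a
renormalised band `e = ε - μ - K` whose shell `{|e| ≤ Λ₁}` in the square has the certified geometry (speed,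
curvature, van Hove distance: `ShellGeometry`) and is a radial graph about `Γ` (`p · ∇e > 0`), the DOUBLE shell
`{|e(p)| ≤ Λ, |e(q - p)| ≤ Λ}` at any pair momentum `q` in the square with `‖q‖ ≥ q₀` has area `≤ C Λ^{3/2}`,
against `≍ Λ` for the single shell (`q = 0`, the Cooper channel): every non-Cooper momentum routing loses
`√Λ ≍ 1/N(Λ)`. -/
def PairShellTransversality : Prop :=
  ∀ (μ : ℝ) (K : TrigPolyC4v) (Λ₁ v₁ v₂ κ₁ κ₂ d q₀ : ℝ), 0 < Λ₁ → 0 < v₁ → 0 < κ₁ → 0 < q₀ →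
    ShellGeometry (renormalisedBandC μ K) Λ₁ v₁ v₂ κ₁ κ₂ d →
    (∀ p : Fin 2 → ℝ, (∀ i, |p i| ≤ Real.pi) → |renormalisedBandC μ K p| ≤ Λ₁ →
        0 < p 0 * partialD 0 (renormalisedBandC μ K) p + p 1 * partialD 1 (renormalisedBandC μ K) p) →
      ∃ C : ℝ, ∀ Λ ∈ Set.Ioc (0 : ℝ) Λ₁, ∀ q : Fin 2 → ℝ, (∀ i, |q i| ≤ Real.pi) → q₀ ≤ ‖q‖ →
        MeasureTheory.volume {p : Fin 2 → ℝ | (∀ i, |p i| ≤ Real.pi) ∧ |renormalisedBandC μ K p| ≤ Λ ∧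
            |renormalisedBandC μ K (q - p)| ≤ Λ} ≤ ENNReal.ofReal (C * Λ ^ ((3 : ℝ) / 2))

/-- Card C (seed-strength-flow), first lemma: ABOVE a fermionic infrared scale `Λ` (`ω² + e_K² ≥ Λ²`) the seed is
a regular Gaussian parameter — every entry of the seeded Nambu propagator in the frame `K`,
`[[iω + e_K, hφ_d],[hφ_d, iω - e_K]]/(ω² + e_K² + h²φ_d²)`, is differentiable in the seed strength `h` on ALL of
`ℝ` with `|∂_h G_{ab}| ≤ |φ_d|/Λ²`, uniformly in `h` (and is analytic in `|h| < Λ/2`). Hence `∂_h` of the scale-`Λ₀`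
effective action is an exact Polchinski step with an `h`-regular slice covariance `Ċ_h = ∂_h C_h^{>Λ₀}`. -/
def SeedSliceBound : Prop :=
  ∀ (L M : ℕ) [NeZero L] (β μ Λ h : ℝ) (K : TrigPolyC4v) (k : FreqMomentum L M) (i j : Fin 2),
    0 < Λ → Λ ^ 2 ≤ matsubaraFreq β M k.1 ^ 2 + nambuXiCT L μ K k.2 ^ 2 →
      DifferentiableAt ℝ (fun h' : ℝ => nambuPropagatorCT L M β μ h' K k i j) h ∧
      ‖deriv (fun h' : ℝ => nambuPropagatorCT L M β μ h' K k i j) h‖ ≤ |dWaveSymbol L k.2| / Λ ^ 2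

/-- Sanity: the three first lemmas are propositions over existing declarations (this file elaborating is the
check asked of a crux idea; nothing is asserted). -/
example : SeedRotationIdentity → PairShellTransversality → SeedSliceBound → True := fun _ _ _ => trivial


/-! ## §2 Card A first lemma, proved -/



section Rotation

variable (L : ℕ)

/-- A constant gauge rotation multiplies every pair annihilator by `conj(g₀)²`. -/
theorem rot_conj_annihilation_mul_annihilation (g₀ : Circle) (x y : FermionTorus 2 L) (σ τ : Fin 2) :
    phaseGauge (fun _ : FermionTorus 2 L => g₀) * (annihilation (orb x σ) * annihilation (orb y τ)) *
        (phaseGauge (fun _ : FermionTorus 2 L => g₀))ᴴ =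
      (conj (g₀ : ℂ) * conj (g₀ : ℂ)) • (annihilation (orb x σ) * annihilation (orb y τ)) := by
  rw [phaseGauge_mul_mul_mul_conjTranspose, phaseGauge_mul_annihilation_mul_conjTranspose,
    phaseGauge_mul_annihilation_mul_conjTranspose, smul_mul_smul_comm]

variable [NeZero L]

/-- `W P_x Wᴴ = conj(g₀)² P_x` for every local pair. -/
theorem rot_conj_localPair (g₀ : Circle) (g : Site 2 → ℝ) (x : TorusSite 2 L) :
    phaseGauge (fun _ : FermionTorus 2 L => g₀) * localPair g L x * (phaseGauge (fun _ : FermionTorus 2 L => g₀))ᴴ =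
      (conj (g₀ : ℂ) * conj (g₀ : ℂ)) • localPair g L x := by
  unfold localPair
  simp only [Finset.mul_sum, Finset.sum_mul, Matrix.mul_smul, Matrix.smul_mul, Matrix.mul_sub,
    Matrix.sub_mul, rot_conj_annihilation_mul_annihilation, Finset.smul_sum]
  refine Finset.sum_congr rfl fun e _ => ?_
  rw [← smul_sub, smul_comm]

/-- `W Δ_g Wᴴ = conj(g₀)² Δ_g`. -/
theorem rot_conj_pairField (g₀ : Circle) (g : Site 2 → ℝ) :
    phaseGauge (fun _ : FermionTorus 2 L => g₀) * pairField g L * (phaseGauge (fun _ : FermionTorus 2 L => g₀))ᴴ =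
      (conj (g₀ : ℂ) * conj (g₀ : ℂ)) • pairField g L := by
  unfold pairField
  simp only [Finset.mul_sum, Finset.sum_mul, rot_conj_localPair, Finset.smul_sum]

/-- `W Δ_gᴴ Wᴴ = g₀² Δ_gᴴ`. -/
theorem rot_conj_pairField_conjTranspose (g₀ : Circle) (g : Site 2 → ℝ) :
    phaseGauge (fun _ : FermionTorus 2 L => g₀) * (pairField g L)ᴴ * (phaseGauge (fun _ : FermionTorus 2 L => g₀))ᴴ =
      ((g₀ : ℂ) * (g₀ : ℂ)) • (pairField g L)ᴴ := by
  rw [phaseGauge_mul_conjTranspose_mul_conjTranspose, rot_conj_pairField, conjTranspose_smul]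
  congr 1
  simp

/-- `W K₀ Wᴴ = K₀`. -/
theorem rot_conj_hubbardTorusWith (g₀ : Circle) (t U μ : ℝ) :
    phaseGauge (fun _ : FermionTorus 2 L => g₀) * hubbardTorusWith 2 L t U μ * (phaseGauge (fun _ : FermionTorus 2 L => g₀))ᴴ =
      hubbardTorusWith 2 L t U μ := by
  unfold hubbardTorusWith; exact phaseGauge_const_conj_hamiltonianWith _ _ t U μ

/-- `Wᴴ W = 1`. -/
theorem rot_conjTranspose_mul_self (g₀ : Circle) :
    (phaseGauge (fun _ : FermionTorus 2 L => g₀))ᴴ * phaseGauge (fun _ : FermionTorus 2 L => g₀) = 1 := by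
  have h := conjTranspose_phaseGauge_mul_self (Λ := FermionTorus 2 L) fun _ => g₀
  convert h

/-- `W Wᴴ = 1`. -/
theorem rot_mul_conjTranspose_self (g₀ : Circle) :
    phaseGauge (fun _ : FermionTorus 2 L => g₀) * (phaseGauge (fun _ : FermionTorus 2 L => g₀))ᴴ = 1 := by
  have h := phaseGauge_mul_conjTranspose_self (Λ := FermionTorus 2 L) fun _ => g₀
  convert h

/-- `W` is unitary. -/
theorem rot_mem_unitaryGroup (g₀ : Circle) :
    phaseGauge (fun _ : FermionTorus 2 L => g₀) ∈
      Matrix.unitaryGroup (Finset (Orb (FermionTorus 2 L))) ℂ := by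
  refine Unitary.mem_iff.2 ⟨?_, ?_⟩
  · rw [star_eq_conjTranspose]; exact rot_conjTranspose_mul_self L g₀
  · rw [star_eq_conjTranspose]; exact rot_mul_conjTranspose_self L g₀

/-- **The complex-seeded torus is gauge-equivalent to the real-seeded one**:
`W (K₀ - z̄Δ - zΔᴴ) Wᴴ = K₀ - |z|(Δ + Δᴴ)` for `W = phaseGauge(e^{-iθ/2})`, `z = a + ib = |z|e^{iθ}`. -/
theorem rot_conj_complexSeed (U μ a b : ℝ) (hr : 0 < Real.sqrt (a ^ 2 + b ^ 2)) :
    phaseGauge (fun _ : FermionTorus 2 L => Circle.exp (-(Complex.arg ((a : ℂ) + b * Complex.I) / 2))) *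
        (hubbardTorusWith 2 L 1 U μ
          - (a : ℂ) • (pairField dWaveFormFactor L + (pairField dWaveFormFactor L)ᴴ)
          - (b : ℂ) • (Complex.I • ((pairField dWaveFormFactor L)ᴴ - pairField dWaveFormFactor L))) *
        (phaseGauge (fun _ : FermionTorus 2 L => Circle.exp (-(Complex.arg ((a : ℂ) + b * Complex.I) / 2))))ᴴ =
      dWaveSourceTorus L U μ (Real.sqrt (a ^ 2 + b ^ 2)) := by
  set θ : ℝ := Complex.arg ((a : ℂ) + b * Complex.I) with hθ
  set r : ℝ := Real.sqrt (a ^ 2 + b ^ 2) with hr_def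
  set z : ℂ := (a : ℂ) + b * Complex.I with hz_def
  set g₀ : Circle := Circle.exp (-(θ / 2)) with hg₀
  set Δ := pairField dWaveFormFactor L with hΔ
  -- the phase: conj(g₀)² = e^{iθ} = z / r and g₀² = conj z / r
  have hnorm : ‖z‖ = r := by
    rw [hz_def, hr_def, Complex.norm_add_mul_I]
  have hr0 : (r : ℂ) ≠ 0 := by exact_mod_cast hr.ne'
  have hzr : z = (r : ℂ) * Complex.exp (θ * Complex.I) := by
    rw [← hnorm]; exact (Complex.norm_mul_exp_arg_mul_I z).symm
  have hg : conj (g₀ : ℂ) = Complex.exp (((θ / 2 : ℝ) : ℂ) * Complex.I) := by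
    rw [hg₀, Circle.coe_exp, ← Complex.exp_conj]
    congr 1
    simp only [map_mul, Complex.conj_ofReal, Complex.conj_I]
    push_cast; ring
  have hconj' : conj (g₀ : ℂ) * conj (g₀ : ℂ) * r = z := by
    rw [hg, ← Complex.exp_add, hzr, mul_comm (Complex.exp _) (r : ℂ)]
    congr 2
    push_cast; ring
  have hconj : conj (g₀ : ℂ) * conj (g₀ : ℂ) = z / r := by
    rw [← hconj', mul_div_cancel_right₀ _ hr0]
  have hsq : (g₀ : ℂ) * (g₀ : ℂ) = conj z / r := by
    have := congrArg conj hconj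
    simp only [map_mul, Complex.conj_conj, map_div₀, Complex.conj_ofReal] at this
    exact this
  rw [Matrix.mul_sub, Matrix.sub_mul, Matrix.mul_sub, Matrix.sub_mul, rot_conj_hubbardTorusWith,
    Matrix.mul_smul, Matrix.smul_mul, Matrix.mul_add, Matrix.add_mul, rot_conj_pairField,
    rot_conj_pairField_conjTranspose, Matrix.mul_smul, Matrix.smul_mul, Matrix.mul_smul, Matrix.smul_mul,
    Matrix.mul_sub, Matrix.sub_mul, rot_conj_pairField, rot_conj_pairField_conjTranspose, hconj, hsq]
  rw [dWaveSourceTorus, ← hΔ, sub_sub]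
  congr 1
  -- scalar bookkeeping: a(wΔ + w̄Δᴴ) + b·i(w̄Δᴴ - wΔ) = r(Δ + Δᴴ), w = z/r
  have hzz : z * conj z = (r : ℂ) ^ 2 := by
    rw [Complex.mul_conj, Complex.normSq_eq_norm_sq, hnorm]; push_cast; ring
  have h1 : (a : ℂ) * (z / r) - (b : ℂ) * Complex.I * (z / r) = r := by
    have : (a : ℂ) - b * Complex.I = conj z := by
      rw [hz_def]; simp only [map_add, map_mul, Complex.conj_ofReal, Complex.conj_I]; ring
    calc (a : ℂ) * (z / r) - (b : ℂ) * Complex.I * (z / r) = ((a : ℂ) - b * Complex.I) * z / r := by ring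
      _ = conj z * z / r := by rw [this]
      _ = (r : ℂ) ^ 2 / r := by rw [mul_comm, hzz]
      _ = r := by field_simp
  have h2 : (a : ℂ) * (conj z / r) + (b : ℂ) * Complex.I * (conj z / r) = r := by
    have : (a : ℂ) + b * Complex.I = z := rfl
    calc (a : ℂ) * (conj z / r) + (b : ℂ) * Complex.I * (conj z / r) = ((a : ℂ) + b * Complex.I) * conj z / r := by ring
      _ = z * conj z / r := by rw [this]
      _ = (r : ℂ) ^ 2 / r := by rw [hzz]
      _ = r := by field_simp
  ext i j
  simp only [Matrix.add_apply, Matrix.sub_apply, Matrix.smul_apply, smul_eq_mul]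
  linear_combination (Δ i j) * h1 + ((Δᴴ) i j) * h2

end Rotation

/-- **Card A first lemma (SeedRotationIdentity), PROVED.** -/
theorem seedRotationIdentity (L : ℕ) [NeZero L] (U μ a b : ℝ) :
    Matrix.groundEnergy (hubbardTorusWith 2 L 1 U μ
        - (a : ℂ) • (pairField dWaveFormFactor L + (pairField dWaveFormFactor L)ᴴ)
        - (b : ℂ) • (Complex.I • ((pairField dWaveFormFactor L)ᴴ - pairField dWaveFormFactor L)))
      = Matrix.groundEnergy (dWaveSourceTorus L U μ (Real.sqrt (a ^ 2 + b ^ 2))) := by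
  rcases (Real.sqrt_nonneg (a ^ 2 + b ^ 2)).eq_or_lt with hr | hr
  · -- degenerate seed: a = b = 0
    have hab : a ^ 2 + b ^ 2 ≤ 0 := Real.sqrt_eq_zero'.1 hr.symm
    have ha : a = 0 := by nlinarith [sq_nonneg a, sq_nonneg b]
    have hb : b = 0 := by nlinarith [sq_nonneg a, sq_nonneg b]
    subst ha; subst hb
    rw [← hr]
    simp
  · have h := rot_conj_complexSeed L U μ a b hr
    simp only at h
    rw [← h]
    exact (Summit.HubbardSuperconductivity.HubbardSuperconductivity.Theorems.VisonPairCost.Negative.groundEnergy_unitary_conj'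
      _ (rot_mem_unitaryGroup L _)).symm


/-- `SeedRotationIdentity` holds (Card A's first lemma, discharged). -/
theorem seedRotationIdentity_holds : SeedRotationIdentity := fun L _ U μ a b => seedRotationIdentity L U μ a b

end Summit.HubbardSuperconductivity.HubbardSuperconductivity.Cruxes.SeededBrokenRegimeBoseFermiPinned.IdeasR1K1
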